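import Mathlib
import Summits.Ventures.HodgeRepro.Tier4.Line1.AdelicSingle
import Summits.Ventures.HodgeRepro.Tier4.Common.PlaceCommute
import Summits.Ventures.HodgeRepro.Tier4.Common.LocalTorus
import Summits.Ventures.HodgeRepro.Tier4.Line4.DichotomyLin

/-!
# Tier4/Line4/LinRegularLocal — C-L4-LINREG-LOCAL: linear regularity read at one finite place

Blind re-derivation cell `pub-hodge-repro`, Tier 4 «prove the step» (README §9–§10), seat t4-L1-p1 (prover, LINE L1,
gen 4; plan-4 g5's cut S15533 after DICH-LIN, statement S15551).  Tree path
`lean/Summits/Ventures/HodgeRepro/Tier4/Line4/LinRegularLocal.lean`.  Mathlib-level; no literature.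

WHAT IS PROVED (every declaration sorry-free, axioms `[propext, Classical.choice, Quot.sound]`).
* Vocabulary: `compFin v M`, `compInf w M` — the component at a place of an adelic matrix (entrywise `adComponentFin` /
  `adComponentInf`); `adMatAt k v A` — a `k`-matrix read in `k_v`; `liftFin v y` — «`y` at `v`, the identity
  elsewhere» (L2-p2's `embMat (singleFin k v)`), with `compFin_liftFin_same`, `compFin_liftFin_of_ne`, `compInf_liftFin`;
  `M4_ext_of_components` — an adelic matrix is determined by its components.
* **`isLinRegular_local (hlin : IsLinRegular W γ₀) (v) (y y') … : ∃ x z : v.adicCompletion k, y = x • 1 + z • adMatAt k v W.Ω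
  ∧ y' = x • 1 + z • adMatAt k v W.Ω`** — the one-place specialisation of the LIN form: LOCAL matrices `y, y'` over
  `k_v` commuting with `Ω`, `P i` (resp. `Ω`, `Q i`) and with `y γ₀ = γ₀ y'` AT `v` are one `E′_v`-scalar.  Proof:
  `Y := liftFin v y`, `Y' := liftFin v y'` satisfy the adelic hypotheses componentwise (at `v` by hypothesis; at every
  other place `1` commutes with everything), so `hlin Y Y'` gives `x z : Ad k`, read at `v`.
* **`finiteComponent_eq_scalar_of_stab_at (hlin) (v) (ht : t ∈ torusT W) (ht' : t' ∈ torusT' W)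
  (h : (t_v)⁻¹ γ₀,v t'_v = γ₀,v) : (∃ x z, ↑(t_v) = x • 1 + z • adMatAt k v W.Ω) ∧ t'_v = t_v`** — the unitary
  consequence («the local stabiliser at `v` is central», PHASE-AT-P's `hregp`): the stabiliser equation at the ONE place
  `v` forces the `v`-components of an adelic torus pair to be equal and `E′_v`-scalar; `…_of_not_transporter_row` — the
  same for a genuine row plane and a non-transporter `γ₀` (DichotomyLin p708957 by name).
* `isRegularRational_localTorusAtFinite` — the adelic restriction (elements supported at `v`), a 1-line corollary of
  `IsRegularRational`, landed for the binder's sake.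

Junk: none — no hypothesis beyond `IsLinRegular` / `IsRegularRational` and the commutations.

Nothing here says anything about the status of the Hodge conjecture for CM abelian varieties, which is NOT proved
(HC_CM is NOT proved by anyone in this repository).
-/

set_option autoImplicit false
noncomputable section
namespace Summit.Ventures.HodgeRepro.Tier4.Line4
open Summit.Ventures.HodgeRepro.Tier4 Summit.Ventures.HodgeRepro.Tier4.Common Summit.Ventures.HodgeRepro.Tier4.Line1
  NumberField IsDedekindDomain Matrix

section Components

variable (k : Type) [Field k] [NumberField k]

/-- **the component at a finite place of an adelic matrix** (entrywise `adComponentFin`). -/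
def compFin (v : HeightOneSpectrum (𝓞 k)) (M : M4 k) : Matrix (Fin 4) (Fin 4) (v.adicCompletion k) :=
  M.map (adComponentFin k v)

/-- **the component at an infinite place of an adelic matrix** (entrywise `adComponentInf`). -/
def compInf (w : InfinitePlace k) (M : M4 k) : Matrix (Fin 4) (Fin 4) w.Completion :=
  M.map (adComponentInf k w)

/-- **a `k`-matrix read in `k_v`**. -/
def adMatAt (v : HeightOneSpectrum (𝓞 k)) (A : Matrix (Fin 4) (Fin 4) k) :
    Matrix (Fin 4) (Fin 4) (v.adicCompletion k) :=
  A.map (algebraMap k (v.adicCompletion k))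

/-- **«`y` at `v`, the identity elsewhere»**: the adelic matrix with component `y` at the finite place `v` and `1` at
every other place (L2-p2's `embMat` along `singleFin k v`). -/
def liftFin (v : HeightOneSpectrum (𝓞 k)) (y : Matrix (Fin 4) (Fin 4) (v.adicCompletion k)) : M4 k :=
  embMat (singleFin k v) y

variable {k}

/-- `compFin` entrywise. -/
theorem compFin_apply (v : HeightOneSpectrum (𝓞 k)) (M : M4 k) (i j : Fin 4) :
    compFin k v M i j = adComponentFin k v (M i j) := rfl

/-- `compInf` entrywise. -/
theorem compInf_apply (w : InfinitePlace k) (M : M4 k) (i j : Fin 4) :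
    compInf k w M i j = adComponentInf k w (M i j) := rfl

/-- **an adelic matrix is determined by its components.** -/
theorem M4_ext_of_components {M M' : M4 k} (hinf : ∀ w : InfinitePlace k, compInf k w M = compInf k w M')
    (hfin : ∀ v : HeightOneSpectrum (𝓞 k), compFin k v M = compFin k v M') : M = M' := by
  ext i j
  apply Ad.ext_of_components
  · intro w
    exact congrFun (congrFun (hinf w) i) j
  · intro v
    exact congrFun (congrFun (hfin v) i) j

/-- `compFin` is multiplicative. -/
theorem compFin_mul (v : HeightOneSpectrum (𝓞 k)) (M N : M4 k) :
    compFin k v (M * N) = compFin k v M * compFin k v N :=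
  Matrix.map_mul

/-- `compInf` is multiplicative. -/
theorem compInf_mul (w : InfinitePlace k) (M N : M4 k) :
    compInf k w (M * N) = compInf k w M * compInf k w N :=
  Matrix.map_mul

/-- `compFin 1 = 1`. -/
theorem compFin_one (v : HeightOneSpectrum (𝓞 k)) : compFin k v (1 : M4 k) = 1 :=
  Matrix.map_one _ (map_zero _) (map_one _)

/-- `compInf 1 = 1`. -/
theorem compInf_one (w : InfinitePlace k) : compInf k w (1 : M4 k) = 1 :=
  Matrix.map_one _ (map_zero _) (map_one _)

/-- `compFin` is additive. -/
theorem compFin_add (v : HeightOneSpectrum (𝓞 k)) (M N : M4 k) :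
    compFin k v (M + N) = compFin k v M + compFin k v N :=
  Matrix.map_add _ (map_add _) M N

/-- `compFin` of an adelic scalar multiple. -/
theorem compFin_smul (v : HeightOneSpectrum (𝓞 k)) (x : Ad k) (M : M4 k) :
    compFin k v (x • M) = adComponentFin k v x • compFin k v M := by
  ext i j
  simp only [compFin_apply, Matrix.smul_apply, smul_eq_mul, map_mul]

/-- the component at `v` of a principal matrix is the matrix read in `k_v`. -/
theorem compFin_adMat_eq_adMatAt (v : HeightOneSpectrum (𝓞 k)) (A : Matrix (Fin 4) (Fin 4) k) :
    compFin k v (adMat k A) = adMatAt k v A := by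
  ext i j
  simp only [compFin_apply, adMat, adMatAt, Matrix.map_apply, adComponentFin_algebraMap]

/-- the component at `w` of a principal matrix is the matrix read in `k_w`. -/
theorem compInf_adMat_eq_map (w : InfinitePlace k) (A : Matrix (Fin 4) (Fin 4) k) :
    compInf k w (adMat k A) = A.map (algebraMap k w.Completion) := by
  ext i j
  simp only [compInf_apply, adMat, Matrix.map_apply]
  rfl

variable (W : PlaneData k)

/-- the component at `v` of the matrix of `g ∈ G(𝔸_k)` is the matrix of its `v`-component. -/
theorem compFin_mat (v : HeightOneSpectrum (𝓞 k)) (g : GA W) :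
    compFin k v (GA.mat W g) =
      ((GA.finiteComponent W v g : GL (Fin 4) (v.adicCompletion k)) : Matrix (Fin 4) (Fin 4) (v.adicCompletion k)) :=
  rfl

/-- the component at `w` of the matrix of `g ∈ G(𝔸_k)` is the matrix of its `w`-component. -/
theorem compInf_mat (w : InfinitePlace k) (g : GA W) :
    compInf k w (GA.mat W g) =
      ((GA.infiniteComponent W w g : GL (Fin 4) w.Completion) : Matrix (Fin 4) (Fin 4) w.Completion) :=
  rfl

/-- `liftFin v y` has component `y` at `v`. -/
theorem compFin_liftFin_same (v : HeightOneSpectrum (𝓞 k)) (y : Matrix (Fin 4) (Fin 4) (v.adicCompletion k)) :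
    compFin k v (liftFin k v y) = y :=
  mapMatrix_embMat_self (adComponentFin k v) (singleFin k v) (adComponentFin_singleFin_same k v) y

/-- `liftFin v y` has component `1` at every other finite place. -/
theorem compFin_liftFin_of_ne {v v' : HeightOneSpectrum (𝓞 k)} (h : v' ≠ v)
    (y : Matrix (Fin 4) (Fin 4) (v.adicCompletion k)) : compFin k v' (liftFin k v y) = 1 :=
  mapMatrix_embMat_zero (adComponentFin k v') (singleFin k v) (fun c => adComponentFin_singleFin_of_ne k h c) y

/-- `liftFin v y` has component `1` at every infinite place. -/
theorem compInf_liftFin (v : HeightOneSpectrum (𝓞 k)) (w : InfinitePlace k)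
    (y : Matrix (Fin 4) (Fin 4) (v.adicCompletion k)) : compInf k w (liftFin k v y) = 1 :=
  mapMatrix_embMat_zero (adComponentInf k w) (singleFin k v) (adComponentInf_singleFin k v w) y

/-- **a local commutation lifts**: if `y` commutes with `A` read in `k_v`, then `liftFin v y` commutes with `adMat A`. -/
theorem liftFin_mul_adMat_comm (v : HeightOneSpectrum (𝓞 k)) {y : Matrix (Fin 4) (Fin 4) (v.adicCompletion k)}
    {A : Matrix (Fin 4) (Fin 4) k} (h : y * adMatAt k v A = adMatAt k v A * y) :
    liftFin k v y * adMat k A = adMat k A * liftFin k v y := by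
  apply M4_ext_of_components
  · intro w
    rw [compInf_mul, compInf_mul, compInf_liftFin, one_mul, mul_one]
  · intro v'
    by_cases hv : v' = v
    · subst hv
      rw [compFin_mul, compFin_mul, compFin_liftFin_same, compFin_adMat_eq_adMatAt]
      exact h
    · rw [compFin_mul, compFin_mul, compFin_liftFin_of_ne hv, one_mul, mul_one]

/-- **a local intertwining lifts**: if `y γ_v = γ_v y'` at `v`, then `liftFin v y · γ = γ · liftFin v y'`. -/
theorem liftFin_mul_mat_eq (v : HeightOneSpectrum (𝓞 k)) (g : GA W)
    {y y' : Matrix (Fin 4) (Fin 4) (v.adicCompletion k)}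
    (h : y * ((GA.finiteComponent W v g : GL (Fin 4) (v.adicCompletion k)) : Matrix (Fin 4) (Fin 4) (v.adicCompletion k)) =
      ((GA.finiteComponent W v g : GL (Fin 4) (v.adicCompletion k)) : Matrix (Fin 4) (Fin 4) (v.adicCompletion k)) * y') :
    liftFin k v y * GA.mat W g = GA.mat W g * liftFin k v y' := by
  apply M4_ext_of_components
  · intro w
    rw [compInf_mul, compInf_mul, compInf_liftFin, compInf_liftFin, one_mul, mul_one]
  · intro v'
    by_cases hv : v' = v
    · subst hv
      rw [compFin_mul, compFin_mul, compFin_liftFin_same, compFin_liftFin_same, compFin_mat]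
      exact h
    · rw [compFin_mul, compFin_mul, compFin_liftFin_of_ne hv, compFin_liftFin_of_ne hv, one_mul, mul_one]

end Components

section LinRegularLocal

variable {k : Type} [Field k] [NumberField k] (W : PlaneData k)

/-- **C-L4-LINREG-LOCAL, matrix form — linear regularity read at one finite place**: local matrices `y, y'` over
`k_v` commuting with `Ω`, `P i` (resp. `Ω`, `Q i`) read in `k_v`, with `y γ₀ = γ₀ y'` at `v`, are one `E′_v`-scalar
`x + zΩ`.  Proof: «`y` at `v`, the identity elsewhere» and its twin satisfy the adelic hypotheses of `IsLinRegular`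
componentwise, and the adelic scalars read at `v` are the local ones. -/
theorem isLinRegular_local {γ₀ : rationalPoints W} (hlin : IsLinRegular W γ₀) (v : HeightOneSpectrum (𝓞 k))
    (y y' : Matrix (Fin 4) (Fin 4) (v.adicCompletion k))
    (hyΩ : y * adMatAt k v W.Ω = adMatAt k v W.Ω * y)
    (hyP : ∀ i, y * adMatAt k v (W.P i) = adMatAt k v (W.P i) * y)
    (hy'Ω : y' * adMatAt k v W.Ω = adMatAt k v W.Ω * y')
    (hy'Q : ∀ i, y' * adMatAt k v (W.Q i) = adMatAt k v (W.Q i) * y')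
    (hyγ : y * ((GA.finiteComponent W v (γ₀ : GA W) : GL (Fin 4) (v.adicCompletion k)) :
        Matrix (Fin 4) (Fin 4) (v.adicCompletion k)) =
      ((GA.finiteComponent W v (γ₀ : GA W) : GL (Fin 4) (v.adicCompletion k)) :
        Matrix (Fin 4) (Fin 4) (v.adicCompletion k)) * y') :
    ∃ x z : v.adicCompletion k, y = x • (1 : Matrix (Fin 4) (Fin 4) (v.adicCompletion k)) + z • adMatAt k v W.Ω ∧
      y' = x • (1 : Matrix (Fin 4) (Fin 4) (v.adicCompletion k)) + z • adMatAt k v W.Ω := by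
  obtain ⟨x, z, hY, hY'⟩ := hlin (liftFin k v y) (liftFin k v y') (liftFin_mul_adMat_comm v hyΩ)
    (fun i => liftFin_mul_adMat_comm v (hyP i)) (liftFin_mul_adMat_comm v hy'Ω)
    (fun i => liftFin_mul_adMat_comm v (hy'Q i)) (liftFin_mul_mat_eq W v (γ₀ : GA W) hyγ)
  refine ⟨adComponentFin k v x, adComponentFin k v z, ?_, ?_⟩
  · have h := congrArg (compFin k v) hY
    rw [compFin_liftFin_same, compFin_add, compFin_smul, compFin_smul, compFin_one, compFin_adMat_eq_adMatAt] at h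
    exact h
  · have h := congrArg (compFin k v) hY'
    rw [compFin_liftFin_same, compFin_add, compFin_smul, compFin_smul, compFin_one, compFin_adMat_eq_adMatAt] at h
    exact h

/-- the `v`-component of an element of the commutant of `A` commutes with `A` read in `k_v`. -/
theorem finiteComponent_comm_of_mem_commutant (v : HeightOneSpectrum (𝓞 k)) {A : Matrix (Fin 4) (Fin 4) k} {g : GA W}
    (hg : g ∈ commutant W A) :
    ((GA.finiteComponent W v g : GL (Fin 4) (v.adicCompletion k)) : Matrix (Fin 4) (Fin 4) (v.adicCompletion k)) *
        adMatAt k v A =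
      adMatAt k v A *
        ((GA.finiteComponent W v g : GL (Fin 4) (v.adicCompletion k)) : Matrix (Fin 4) (Fin 4) (v.adicCompletion k)) := by
  have h : GA.mat W g * adMat k A = adMat k A * GA.mat W g := hg
  have h' := congrArg (compFin k v) h
  rw [compFin_mul, compFin_mul, compFin_adMat_eq_adMatAt, compFin_mat] at h'
  exact h'

/-- the `v`-component of any `g ∈ G(𝔸_k)` commutes with `Ω` read in `k_v`. -/
theorem finiteComponent_comm_Ω (v : HeightOneSpectrum (𝓞 k)) (g : GA W) :
    ((GA.finiteComponent W v g : GL (Fin 4) (v.adicCompletion k)) : Matrix (Fin 4) (Fin 4) (v.adicCompletion k)) *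
        adMatAt k v W.Ω =
      adMatAt k v W.Ω *
        ((GA.finiteComponent W v g : GL (Fin 4) (v.adicCompletion k)) : Matrix (Fin 4) (Fin 4) (v.adicCompletion k)) := by
  have h : GA.mat W g * adMat k W.Ω = adMat k W.Ω * GA.mat W g := ((mem_unitaryGroup W (g : GL4 k)).1 g.2).1
  have h' := congrArg (compFin k v) h
  rw [compFin_mul, compFin_mul, compFin_adMat_eq_adMatAt, compFin_mat] at h'
  exact h'

/-- **C-L4-LINREG-LOCAL, unitary form — the local stabiliser at `v` is central** (PHASE-AT-P's `hregp`): for an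
adelic torus pair `t ∈ T`, `t' ∈ T′` whose `v`-components satisfy the stabiliser equation `t_v⁻¹ γ₀,v t'_v = γ₀,v` at
the ONE place `v`, the `v`-component of `t` is an `E′_v`-scalar `x + zΩ` and `t'_v = t_v`. -/
theorem finiteComponent_eq_scalar_of_stab_at {γ₀ : rationalPoints W} (hlin : IsLinRegular W γ₀)
    (v : HeightOneSpectrum (𝓞 k)) {t t' : GA W} (ht : t ∈ torusT W) (ht' : t' ∈ torusT' W)
    (h : (GA.finiteComponent W v t)⁻¹ * GA.finiteComponent W v (γ₀ : GA W) * GA.finiteComponent W v t' =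
      GA.finiteComponent W v (γ₀ : GA W)) :
    (∃ x z : v.adicCompletion k,
      ((GA.finiteComponent W v t : GL (Fin 4) (v.adicCompletion k)) : Matrix (Fin 4) (Fin 4) (v.adicCompletion k)) =
        x • (1 : Matrix (Fin 4) (Fin 4) (v.adicCompletion k)) + z • adMatAt k v W.Ω) ∧
    GA.finiteComponent W v t' = GA.finiteComponent W v t := by
  -- the intertwining at `v`: `t_v γ_v = γ_v t'_v`
  have hmul : GA.finiteComponent W v t * GA.finiteComponent W v (γ₀ : GA W) =
      GA.finiteComponent W v (γ₀ : GA W) * GA.finiteComponent W v t' := by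
    calc GA.finiteComponent W v t * GA.finiteComponent W v (γ₀ : GA W)
        = GA.finiteComponent W v t * ((GA.finiteComponent W v t)⁻¹ * GA.finiteComponent W v (γ₀ : GA W) *
            GA.finiteComponent W v t') := by rw [h]
      _ = GA.finiteComponent W v (γ₀ : GA W) * GA.finiteComponent W v t' := by group
  have hyγ : ((GA.finiteComponent W v t : GL (Fin 4) (v.adicCompletion k)) :
        Matrix (Fin 4) (Fin 4) (v.adicCompletion k)) *
      ((GA.finiteComponent W v (γ₀ : GA W) : GL (Fin 4) (v.adicCompletion k)) :
        Matrix (Fin 4) (Fin 4) (v.adicCompletion k)) =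
      ((GA.finiteComponent W v (γ₀ : GA W) : GL (Fin 4) (v.adicCompletion k)) :
        Matrix (Fin 4) (Fin 4) (v.adicCompletion k)) *
      ((GA.finiteComponent W v t' : GL (Fin 4) (v.adicCompletion k)) :
        Matrix (Fin 4) (Fin 4) (v.adicCompletion k)) := by
    have := congrArg (fun u : GL (Fin 4) (v.adicCompletion k) => (u : Matrix (Fin 4) (Fin 4) (v.adicCompletion k))) hmul
    simpa only [Units.val_mul] using this
  obtain ⟨x, z, hy, hy'⟩ := isLinRegular_local W hlin v _ _ (finiteComponent_comm_Ω W v t)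
    (fun i => finiteComponent_comm_of_mem_commutant W v (by
      fin_cases i
      · exact ht.1
      · exact ht.2))
    (finiteComponent_comm_Ω W v t')
    (fun i => finiteComponent_comm_of_mem_commutant W v (by
      fin_cases i
      · exact ht'.1
      · exact ht'.2)) hyγ
  refine ⟨⟨x, z, hy⟩, ?_⟩
  apply Units.ext
  rw [hy', hy]

/-- **the unitary form for a genuine row plane and a non-transporter `γ₀`** (DichotomyLin p708957 by name). -/
theorem finiteComponent_eq_scalar_of_stab_at_of_not_transporter_row (hg : IsGenuineRow W) (γ₀ : rationalPoints W)
    (hT : (torusT W).map (MulAut.conj ((γ₀ : GA W))⁻¹).toMonoidHom ≠ torusT' W)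
    (v : HeightOneSpectrum (𝓞 k)) {t t' : GA W} (ht : t ∈ torusT W) (ht' : t' ∈ torusT' W)
    (h : (GA.finiteComponent W v t)⁻¹ * GA.finiteComponent W v (γ₀ : GA W) * GA.finiteComponent W v t' =
      GA.finiteComponent W v (γ₀ : GA W)) :
    (∃ x z : v.adicCompletion k,
      ((GA.finiteComponent W v t : GL (Fin 4) (v.adicCompletion k)) : Matrix (Fin 4) (Fin 4) (v.adicCompletion k)) =
        x • (1 : Matrix (Fin 4) (Fin 4) (v.adicCompletion k)) + z • adMatAt k v W.Ω) ∧
    GA.finiteComponent W v t' = GA.finiteComponent W v t :=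
  finiteComponent_eq_scalar_of_stab_at W (isLinRegular_of_not_transporter_row W hg γ₀ hT) v ht ht' h

/-- **the adelic restriction** (elements supported at `v`): a 1-line corollary of `IsRegularRational`, landed for the
binder's sake. -/
theorem isRegularRational_localTorusAtFinite {γ₀ : rationalPoints W} (hreg : IsRegularRational W γ₀)
    (v : HeightOneSpectrum (𝓞 k)) {t t' : GA W} (ht : t ∈ localTorusAtFinite W v)
    (ht' : t' ∈ localTorusAtFinite' W v) (h : t⁻¹ * (γ₀ : GA W) * t' = γ₀) : t ∈ centre W ∧ t' = t :=
  hreg t ht.1 t' ht'.1 h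

end LinRegularLocal

end Summit.Ventures.HodgeRepro.Tier4.Line4

end
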